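import Summits.RiemannHypothesis.RiemannHypothesis.Theorems.ThetaTier2Bridge
import Summits.RiemannHypothesis.RiemannHypothesis.Theorems.ThetaTier2Constants
import Summits.RiemannHypothesis.RiemannHypothesis.Theorems.WeilColumnBSplineUnimodal
import HarnessLib

/-!
# THETA tier-2 — the BRIDGE, part 2: `T2Matches (ofRow2 r) r.inp r.real`, admissibility, and UC(q) for a certified row (RH-FREE)

WEIL column (LADDER-RH, W-P(P2); route `WeilSemilocal`, item 19172; cc-s2-1 gen23 request S 20:45:12Z «export `UC2`»). From part 1's identities,
cc-s2-1's `ThetaTier2RowData` (data fields, side conditions, layer window), this seat's `WeilColumnBSplineUnimodal` (cellwise `|χ′|`) and the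
named ℚ-facts `ZetaHyp m`/`LambdaHyp m` (tier 1; `m = 5`: `ThetaTier2Constants`) and the Irwin–Hall density identity
`IH_{m−1}(s) − IH_{m−1}(s−1) ≤ ihPdf m s` at the ≤ 5 points a row uses (hypothesis `hC`; `m = 5`: `decide +kernel` here):

* `admissible_ofRow2 : r.RowFacts → (ofRow2 r).Admissible r.qn`;
* `matches_ofRow2 : r.RowFacts → ZetaHyp r.m → LambdaHyp r.m → hC → T2Matches (ofRow2 r) r.inp r.real`;
* **`uc2_of_valid`**: `T2Valid r.inp r.real → r.RowFacts → ZetaHyp r.m → LambdaHyp r.m → hC → ConsecutivePrimes r.q r.qn →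
  weilSemilocalThreshold (primesBelow r.q) < log r.qn / 2` (`ucT2Cheb_of_valid`; hypothesis-free in `ψ`), and the `m = 5` form
  **`uc2_of_valid_five : T2Valid r.inp r.real → r.RowFacts → r.m = 5 → ConsecutivePrimes r.q r.qn → UC(q)`** — the theorem cc-s2-1's
  19172 closer consumes.
Nothing here bears on the truth of RH.
-/

set_option linter.dupNamespace false
set_option autoImplicit false

namespace Summit.RiemannHypothesis.RiemannHypothesis.Theorems.ThetaTier2

open Summit.RiemannHypothesis.RiemannHypothesis.Theorems.WeilColumn.ThetaMellin
open ThetaTier1 (IH zetaHi pLamHi GAMMA_LO ZetaHyp LambdaHyp)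
open Finset

noncomputable section

namespace Row2

variable (r : Row2)

/-! ## The cut-derivative values: the clamp form and the `m = 5` ℚ-facts -/

/-- The point of the depth cell `j` nearest the mode `η′/2` (in ℚ): `t*_j = max (jτ) (min (η′/2) ((j+1)τ))`. [TIER2-KERNEL-SPEC §1] -/
def tstar (j : ℕ) : ℚ := max ((j : ℚ) * TAU) (min (r.eta / 2) (((j : ℚ) + 1) * TAU))

variable {r}

/-- The kernel's `cutDerVal` is `(m/η′)·ihPdf m (m t*_j/η′)` inside the cut layer. [TIER2-KERNEL-SPEC §1] -/
theorem cutDerVal_eq_clamp {j : ℕ} (hj : ¬ r.eta ≤ (j : ℚ) * TAU) :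
    r.cutDerVal j = r.m / r.eta * ihPdf r.m (r.m * r.tstar j / r.eta) := by
  have hη := r.eta_pos
  have hτ : (0 : ℚ) < TAU := by unfold TAU; norm_num
  unfold cutDerVal tstar
  rw [if_neg hj]
  split_ifs with hmode hlt
  · -- the mode lies in the cell: `t* = η′/2`
    rw [min_eq_left hmode.2, max_eq_right hmode.1]
    congr 1
    field_simp
  · -- cell below the mode: `t* = (j+1)τ`
    rw [min_eq_right hlt.le, max_eq_right (by nlinarith)]
  · -- cell above the mode: `t* = jτ`
    have h1 : r.eta / 2 ≤ ((j : ℚ) + 1) * TAU := not_lt.1 hlt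
    have h2 : r.eta / 2 < (j : ℚ) * TAU := by
      by_contra h; exact hmode ⟨not_lt.1 h, h1⟩
    rw [min_eq_left h1, max_eq_left h2.le]

/-- **The Irwin–Hall density identity at the points of an `m = 5` row** (menu 0: `s = 5/2`; else `s ∈ {1, 2, 5/2, 3, 4}`):
`IH 4 s − IH 4 (s−1) ≤ ihPdf 5 s` (`decide +kernel`). [folklore: `f_IH(m;s) = F_{m−1}(s) − F_{m−1}(s−1)`] -/
theorem cutDer_five (hm : r.m = 5) : ∀ j < r.ncut, ¬ r.eta ≤ (j : ℚ) * TAU →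
    IH (r.m - 1) (r.m * r.tstar j / r.eta) - IH (r.m - 1) (r.m * r.tstar j / r.eta - 1) ≤ ihPdf r.m (r.m * r.tstar j / r.eta) := by
  have key : ∀ s ∈ [(1 : ℚ), 2, 5 / 2, 3, 4], IH 4 s - IH 4 (s - 1) ≤ ihPdf 5 s := by decide +kernel
  intro j hj _
  rw [hm]
  have hncut : r.ncut = (if r.menu = 0 then 1 else 5) := by
    unfold ncut eta TAU; split_ifs <;> norm_num
  have hs : ((5 : ℕ) : ℚ) * r.tstar j / r.eta ∈ [(1 : ℚ), 2, 5 / 2, 3, 4] := by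
    unfold tstar eta TAU
    by_cases hmenu : r.menu = 0
    · rw [hncut, if_pos hmenu] at hj
      interval_cases j
      simp only [hmenu, if_true]; norm_num
    · rw [hncut, if_neg hmenu] at hj
      interval_cases j <;> simp only [hmenu, if_false] <;> norm_num
  exact key _ hs

/-- **The cut-derivative field dominates `|χ′(x₁ − t)|` on every depth cell** (Unimodal's `abs_cut_deriv_depth_le_cell` + the ℚ-facts;
beyond the cut layer `χ′ = 0`). [TIER2-KERNEL-SPEC §1/§5 (K1)] -/
theorem cpb_ge (hm2 : 2 ≤ r.m)
    (hC : ∀ j < r.ncut, ¬ r.eta ≤ (j : ℚ) * TAU →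
      IH (r.m - 1) (r.m * r.tstar j / r.eta) - IH (r.m - 1) (r.m * r.tstar j / r.eta - 1) ≤ ihPdf r.m (r.m * r.tstar j / r.eta))
    (j : ℕ) (t : ℝ) (ht1 : (j : ℝ) * r.real.τ ≤ t) (ht2 : t ≤ ((j : ℝ) + 1) * r.real.τ) :
    |(bsplineDensity ((ofRow2 r).η / (2 * (ofRow2 r).m)) ((ofRow2 r).m - 1) ((ofRow2 r).x₁ - t + (ofRow2 r).a - (ofRow2 r).η / 2)).re| ≤
      r.real.cpb j := by
  have hη : 0 < (ofRow2 r).η := by simp only [ofRow2_η]; exact_mod_cast r.eta_pos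
  have hm1' : 1 ≤ (ofRow2 r).m := show 1 ≤ r.m by omega
  have hτ : r.real.τ = ((TAU : ℚ) : ℝ) := r.real_τ
  have hzero : (r.eta : ℝ) ≤ t →
      |(bsplineDensity ((ofRow2 r).η / (2 * (ofRow2 r).m)) ((ofRow2 r).m - 1) ((ofRow2 r).x₁ - t + (ofRow2 r).a - (ofRow2 r).η / 2)).re| = 0 :=
    fun h ↦ by rw [(ofRow2 r).cut_deriv_depth_eq_zero hη hm2 (by simpa using h), abs_zero]
  show _ ≤ (if j < r.ncut then ((r.cutDerVal j : ℚ) : ℝ) else 0)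
  split_ifs with hj
  · by_cases hjη : r.eta ≤ (j : ℚ) * TAU
    · have hle : (r.eta : ℝ) ≤ t := by
        have h' : ((r.eta : ℚ) : ℝ) ≤ (((j : ℚ) * TAU : ℚ) : ℝ) := by exact_mod_cast hjη
        push_cast at h'; rw [hτ] at ht1; linarith
      rw [hzero hle]
      unfold cutDerVal; rw [if_pos hjη]; simp
    · rw [cutDerVal_eq_clamp hjη]
      have hcell := (ofRow2 r).abs_cut_deriv_depth_le_cell hη hm1' ht1 ht2
      refine hcell.trans ?_
      rw [(ofRow2 r).bsplineDensity_re_eq_irwinHall_sub hη hm2]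
      have hm1 : 1 ≤ r.m - 1 := by omega
      have htstar : max ((j : ℝ) * r.real.τ) (min ((ofRow2 r).η / 2) (((j : ℝ) + 1) * r.real.τ)) = ((r.tstar j : ℚ) : ℝ) := by
        rw [hτ, ofRow2_η]; unfold tstar; push_cast; rfl
      have hs : ((ofRow2 r).m : ℝ) * (((r.tstar j : ℚ) : ℝ) - (ofRow2 r).η / 2 + (ofRow2 r).η / 2) / (ofRow2 r).η =
          (((r.m * r.tstar j / r.eta : ℚ)) : ℝ) := by
        rw [ofRow2_η, ofRow2_m]; push_cast; ring
      have hs1 : (((r.m * r.tstar j / r.eta : ℚ)) : ℝ) - 1 = (((r.m * r.tstar j / r.eta - 1 : ℚ)) : ℝ) := by push_cast; ring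
      rw [htstar, hs, hs1, show (ofRow2 r).m - 1 = r.m - 1 from rfl, irwinHall_eq_IH hm1, irwinHall_eq_IH hm1, ofRow2_m, ofRow2_η]
      have hfac : (0 : ℝ) ≤ ((r.m : ℚ) : ℝ) / ((r.eta : ℚ) : ℝ) := by have := r.eta_pos; push_cast; positivity
      have hk' : (((IH (r.m - 1) (r.m * r.tstar j / r.eta) - IH (r.m - 1) (r.m * r.tstar j / r.eta - 1) : ℚ)) : ℝ) ≤
          ((ihPdf r.m (r.m * r.tstar j / r.eta) : ℚ) : ℝ) := by exact_mod_cast hC j hj hjη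
      have := mul_le_mul_of_nonneg_left hk' hfac
      push_cast at this ⊢
      linarith
  · have hle : (r.eta : ℝ) ≤ t := by
      have h1 := r.eta_le_ncut_mul_tau
      have h2 : (r.inp.ncut : ℝ) * r.real.τ ≤ (j : ℝ) * r.real.τ :=
        mul_le_mul_of_nonneg_right (by rw [r.inp_ncut]; exact_mod_cast not_lt.1 hj) r.real_τ_pos.le
      linarith
    rw [hzero hle]

/-! ## Residues -/

/-- `Σ_{k=1}^{K} k^{−s} ≤ ζ-tail(s)` (`s ≥ 2`). [folklore] -/
theorem sum_Ico_le_zetaTail {s : ℕ} (hs : 2 ≤ s) (K : ℕ) :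
    ∑ k ∈ Ico 1 (K + 1), 1 / (k : ℝ) ^ s ≤ ThetaParams.zetaTail s := by
  have hf := summable_one_div_nat_pow' hs
  have h1 := hf.sum_le_tsum (Ico 1 (K + 1)) (fun i _ ↦ by positivity)
  have h2 : ∑' k : ℕ, 1 / (k : ℝ) ^ s = ThetaParams.zetaTail s := by
    rw [hf.tsum_eq_zero_add]
    simp only [Nat.cast_zero, zero_pow (by omega : s ≠ 0), div_zero, zero_add]
    unfold ThetaParams.zetaTail
    push_cast
    rfl
  rwa [h2] at h1

/-- The kernel's residue `resid1` as a real: `ζ⁺(m+1) − Σ_{k=1}^{6} k^{−(m+1)}`. [bookkeeping] -/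
theorem resid1_cast : ((r.resid1 : ℚ) : ℝ) = ((zetaHi (r.m + 1) : ℚ) : ℝ) - ∑ k ∈ Ico 1 (KH + 1), 1 / (k : ℝ) ^ (r.m + 1) := by
  unfold resid1 KH
  rw [Finset.sum_Ico_eq_sum_range]
  simp only [List.range_succ, List.range_zero, List.map_append, List.map_cons, List.map_nil, List.sum_append, List.sum_cons,
    List.sum_nil, List.nil_append, Finset.sum_range_succ, Finset.sum_range_zero]
  push_cast
  ring

/-- `resid0` as a real: `ζ⁺(m) − Σ_{k=1}^{6} k^{−m}`. [bookkeeping] -/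
theorem resid0_cast : ((r.resid0 : ℚ) : ℝ) = ((zetaHi r.m : ℚ) : ℝ) - ∑ k ∈ Ico 1 (KH + 1), 1 / (k : ℝ) ^ r.m := by
  unfold resid0 KH
  rw [Finset.sum_Ico_eq_sum_range]
  simp only [List.range_succ, List.range_zero, List.map_append, List.map_cons, List.map_nil, List.sum_append, List.sum_cons,
    List.sum_nil, List.nil_append, Finset.sum_range_succ, Finset.sum_range_zero]
  push_cast
  ring

/-! ## Admissibility -/

/-- **Admissibility of the row's parameters** from the certified side conditions. [TIER2-KERNEL-SPEC §4] -/
theorem admissible_ofRow2 (hF : r.RowFacts) : (ofRow2 r).Admissible r.qn := by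
  have hq := hF.two_le_q
  have hd : (0 : ℝ) < r.delta := by exact_mod_cast hF.delta_pos
  have he : (((r.eps : ℚ)) : ℝ) = 2 * (r.delta : ℝ) := by unfold Row2.eps; rw [c2_eq_one]; push_cast; ring
  have heps : (ofRow2 r).ε = 2 * (r.delta : ℝ) := by rw [eps_eq, he]
  have h1 : (((r.eps : ℚ)) : ℝ) < (((r.m0 - r.c1) / 4 : ℚ) : ℝ) := by exact_mod_cast hF.eps_lt₁
  have h2 : (((r.eps : ℚ)) : ℝ) < (((r.c2 - r.m0) / 4 : ℚ) : ℝ) := by exact_mod_cast hF.eps_lt₂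
  push_cast at h1 h2
  rw [he] at h1 h2
  have hη : (0 : ℝ) < r.eta := by exact_mod_cast r.eta_pos
  have hηle : (r.eta : ℝ) ≤ 1 / 20 := by
    have h' : ((r.eta : ℚ) : ℝ) ≤ ((1 / 20 : ℚ) : ℝ) := by exact_mod_cast r.eta_le
    push_cast at h'; exact h'
  have hlog : Real.log 2 ≤ Real.log r.q := Real.log_le_log (by norm_num) (by exact_mod_cast hq)
  have hl2 : (6931 / 10000 : ℝ) < Real.log 2 := by linarith [Real.log_two_gt_d9]
  have hc1 : (0 : ℝ) < r.c1 := by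
    have h' : (0 : ℚ) < r.c1 := by unfold Row2.c1; split_ifs <;> norm_num
    exact_mod_cast h'
  have hc2 : ((r.c2 : ℚ) : ℝ) = 1 := by rw [c2_eq_one, Rat.cast_one]
  exact
    { three_le := hF.three_le_m
      delta_pos := hd
      window := by simpa using hF.window
      exp_lt_two := by simpa using hF.exp_lt_two
      eta_pos := hη
      eta_lt := by show (r.eta : ℝ) < Real.log r.q / 2 + r.delta; linarith
      c₁_pos := hc1
      c₂_pos := by show (0 : ℝ) < ((r.c2 : ℚ) : ℝ); rw [hc2]; norm_num
      seed₁ := by show (r.c1 : ℝ) + (ofRow2 r).ε < r.m0; rw [heps]; linarith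
      seed₂ := by show (r.m0 : ℝ) < (r.c2 : ℝ) - (ofRow2 r).ε; rw [heps]; linarith
      eps_small₁ := by show (ofRow2 r).ε < ((r.m0 : ℝ) - r.c1) / 4; rw [heps]; linarith
      eps_small₂ := by show (ofRow2 r).ε < ((r.c2 : ℝ) - r.m0) / 4; rw [heps]; linarith }

/-! ## `T2Matches` for a certified row -/

/-- **The E-side meaning of the row's reals** (`T2Matches (ofRow2 r) r.inp r.real`). [this seat; TIER2-KERNEL-SPEC §1/§4/§5] -/
theorem matches_ofRow2 (hF : r.RowFacts) (hZ : ZetaHyp r.m) (hΛ : LambdaHyp r.m)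
    (hC : ∀ j < r.ncut, ¬ r.eta ≤ (j : ℚ) * TAU →
      IH (r.m - 1) (r.m * r.tstar j / r.eta) - IH (r.m - 1) (r.m * r.tstar j / r.eta - 1) ≤ ihPdf r.m (r.m * r.tstar j / r.eta)) :
    (ofRow2 r).T2Matches r.inp r.real := by
  have hq := hF.two_le_q
  have hm3 := hF.three_le_m
  have hm1 : 1 ≤ r.m := by omega
  have hm2 : 2 ≤ r.m := by omega
  have hd : 0 < r.delta := hF.delta_pos
  have hdR : (0 : ℝ) < r.delta := by exact_mod_cast hd
  have hqR := q_pos_real hq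
  have hsq := Real.sqrt_pos.2 hqR
  have hA := admissible_ofRow2 hF
  have hcsQ : 0 < r.csum := by
    have h1 := hF.eps_lt₁; have h2 := hF.eps_lt₂
    have heps0 : 0 ≤ r.eps := by unfold Row2.eps; rw [c2_eq_one]; linarith
    unfold Row2.csum Row2.alpha
    have hnum : 0 < r.c2 - r.eps - r.m0 := by linarith
    have hden : 0 < r.m0 - r.c1 - r.eps := by linarith
    have := div_pos hnum hden
    linarith
  have hzeta := zetaTail_nonneg (r.m + 1)
  have hζle : ThetaParams.zetaTail (r.m + 1) ≤ ((zetaHi (r.m + 1) : ℚ) : ℝ) := hZ.1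
  obtain ⟨hM0, hMle⟩ := M_le hq hm1 hd hcsQ hZ
  obtain ⟨hM10, hM1le⟩ := M1_le hq hd hZ hcsQ.le
  have hKW : (r.inp.Kw : ℝ) * r.real.τ = 4 := by rw [r.inp_Kw, r.real_τ, KW_mul_TAU]
  -- the residues
  have hRge : ThetaParams.zetaTail ((ofRow2 r).m + 1) - ∑ k ∈ Ico 1 (r.inp.K + 1), 1 / (k : ℝ) ^ ((ofRow2 r).m + 1) ≤ r.real.R := by
    show _ ≤ ((r.resid1 : ℚ) : ℝ)
    rw [resid1_cast, r.inp_K, ofRow2_m]; linarith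
  have hR0 : 0 ≤ r.real.R := by
    show (0 : ℝ) ≤ ((r.resid1 : ℚ) : ℝ)
    rw [resid1_cast]; linarith [sum_Ico_le_zetaTail (s := r.m + 1) (by omega) KH]
  have hRmge : ThetaParams.zetaTail (ofRow2 r).m - ∑ k ∈ Ico 1 (r.inp.K + 1), 1 / (k : ℝ) ^ (ofRow2 r).m ≤ r.real.Rm := by
    show _ ≤ ((r.resid0 : ℚ) : ℝ)
    rw [resid0_cast, r.inp_K, ofRow2_m]; linarith [hZ.2]
  have hRm0 : 0 ≤ r.real.Rm := by
    show (0 : ℝ) ≤ ((r.resid0 : ℚ) : ℝ)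
    rw [resid0_cast]; linarith [sum_Ico_le_zetaTail (s := r.m) hm2 KH, hZ.2]
  -- the Chebyshev constant, the tails
  have hC0 : 0 ≤ r.real.C := by
    show (0 : ℝ) ≤ 2 * Real.log 2 + 2 * (Real.log r.q + ((2 * r.delta - 2 * r.eta : ℚ) : ℝ)) * Real.exp ((r.eta - r.delta : ℚ) : ℝ)
      * (Real.sqrt r.q)⁻¹
    have h2 : 0 ≤ Real.log r.q + ((2 * r.delta - 2 * r.eta : ℚ) : ℝ) := by linarith [hF.logN]
    have hl2 : 0 ≤ Real.log 2 := Real.log_nonneg (by norm_num)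
    positivity
  have hsq' : ThetaParams.zetaTail (r.m + 1) ^ 2 ≤ ((zetaHi (r.m + 1) : ℚ) : ℝ) ^ 2 := pow_le_pow_left₀ hzeta hζle 2
  have hm0 : (0 : ℝ) < r.m := by exact_mod_cast (show 0 < r.m by omega)
  have hTge : ThetaParams.zetaTail ((ofRow2 r).m + 1) ^ 2 * Real.exp (-((ofRow2 r).m : ℝ) * ((r.inp.Kw : ℝ) * r.real.τ)) *
      ((r.inp.Kw : ℝ) * r.real.τ / (ofRow2 r).m + 1 / ((ofRow2 r).m : ℝ) ^ 2) ≤ r.real.T := by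
    rw [r.real_T_eq, hKW, ofRow2_m]
    have : 0 ≤ Real.exp (-(r.m : ℝ) * 4) * (4 / r.m + 1 / (r.m : ℝ) ^ 2) := by positivity
    nlinarith [mul_le_mul_of_nonneg_right hsq' this]
  have hGtge : ThetaParams.zetaTail ((ofRow2 r).m + 1) ^ 2 * ((r.inp.Kw : ℝ) * r.real.τ) *
      Real.exp (-(((ofRow2 r).m : ℝ) + 1) * ((r.inp.Kw : ℝ) * r.real.τ)) ≤ r.real.Gt := by
    rw [r.real_Gt_eq, hKW, ofRow2_m]
    have : 0 ≤ 4 * Real.exp (-((r.m : ℝ) + 1) * 4) := by positivity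
    nlinarith [mul_le_mul_of_nonneg_right hsq' this]
  -- closed forms of the small atoms
  have hra : 4 * (ofRow2 r).δ * Real.exp (ofRow2 r).δ * (ofRow2 r).hmax ≤ r.real.ra := by
    rw [hmax_eq]
    show _ ≤ ((4 * r.delta * r.hmax : ℚ) : ℝ) * Real.exp ((r.delta : ℚ) : ℝ)
    simp only [ofRow2_δ]; push_cast; exact le_of_eq (by ring)
  have hrb : 2 * (ofRow2 r).δ * (Real.exp (ofRow2 r).δ / Real.sqrt (ofRow2 r).q) ≤ r.real.rb := by
    show _ ≤ ((2 * r.delta : ℚ) : ℝ) * Real.exp ((r.delta : ℚ) : ℝ) * (Real.sqrt r.q)⁻¹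
    simp only [ofRow2_δ, ofRow2_q]; push_cast; exact le_of_eq (by ring)
  have hrc : 2 * Real.log (ofRow2 r).q / Real.sqrt (ofRow2 r).q ≤ r.real.rc := by
    show _ ≤ 2 * Real.log r.q * (Real.sqrt r.q)⁻¹
    simp only [ofRow2_q]; exact le_of_eq (by ring)
  have heml : Real.exp ((ofRow2 r).m * (2 * (ofRow2 r).δ - (ofRow2 r).η)) ≤ r.real.eml := by
    show _ ≤ Real.exp (((r.m * (2 * r.delta - r.eta) : ℚ)) : ℝ)
    simp only [ofRow2_m, ofRow2_δ, ofRow2_η]; push_cast; exact le_rfl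
  -- the gain profile
  have hRt0 : ∀ τ : ℝ, 0 ≤ (ofRow2 r).Rtop τ := fun τ ↦ ((ofRow2 r).Rtop_mem_Icc hA τ).1
  have hRa0 : ∀ j, 0 ≤ r.real.Ra j := fun j ↦ by
    show (0 : ℝ) ≤ ((r.gainA j : ℚ) : ℝ); rw [gainA_eq hm1]; exact hRt0 _
  have hRb0 : ∀ j, 0 ≤ r.real.Rb j := fun j ↦ by
    show (0 : ℝ) ≤ ((r.gainB j : ℚ) : ℝ); rw [gainB_eq hm1]; exact hRt0 _
  have hRa : ∀ j < r.inp.gainPairs.length, r.real.Ra j ≤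
      (ofRow2 r).Rtop ((((ofRow2 r).δ * j / r.inp.gainPairs.length) - ((ofRow2 r).δ * j / r.inp.gainPairs.length) ^ 2 / 2) /
        (2 * (ofRow2 r).δ)) := fun j _ ↦ by
    show ((r.gainA j : ℚ) : ℝ) ≤ _
    rw [gainA_eq hm1, r.inp_gainPairs_length]; unfold JG; simp only [ofRow2_δ, Nat.cast_ofNat]; exact le_rfl
  have hRb : ∀ j < r.inp.gainPairs.length, r.real.Rb j ≤
      (ofRow2 r).Rtop (((2 * (ofRow2 r).δ - (ofRow2 r).δ * (j + 1) / r.inp.gainPairs.length) -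
        (2 * (ofRow2 r).δ - (ofRow2 r).δ * (j + 1) / r.inp.gainPairs.length) ^ 2 / 2) / (2 * (ofRow2 r).δ)) := fun j _ ↦ by
    show ((r.gainB j : ℚ) : ℝ) ≤ _
    rw [gainB_eq hm1, r.inp_gainPairs_length]; unfold JG; simp only [ofRow2_δ, Nat.cast_ofNat]; exact le_rfl
  -- the layer window
  have hlo : r.inp.j0 < r.inp.j1p → (r.inp.j0 : ℝ) * r.real.τ ≤ (ofRow2 r).η - 2 * (ofRow2 r).δ := fun h ↦ by
    have := r.j0_mul_tau_le (by rwa [r.inp_j0, r.inp_j1p] at h)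
    simpa only [ofRow2_η, ofRow2_δ] using this
  have hhi : r.inp.j0 < r.inp.j1p → (ofRow2 r).η ≤ (r.inp.j1p : ℝ) * r.real.τ := fun h ↦ by
    have := r.eta_le_j1p_mul_tau (by rwa [r.inp_j0, r.inp_j1p] at h)
    simpa only [ofRow2_η] using this
  exact
    { m_eq := r.inp_m
      τ_pos := r.real_τ_pos
      θ₀_eq := (θ₀_eq hq).symm
      M₀_eq := (M₀_eq hq).symm
      M₁₀_eq := (M₁₀_eq hq).symm
      c₂_eq := rfl
      ε_eq := eps_eq.symm
      R_ge := hRge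
      R_nonneg := hR0
      Rm_ge := hRmge
      Rm_nonneg := hRm0
      u₁_ge := (u1_eq hq).le
      Mb_ge := hMle
      Mb1_ge := hM1le
      E1_ge := by rw [r.real_E1_eq]; exact le_rfl
      E2_ge := by rw [r.real_E2_eq]; exact le_rfl
      E3_ge := by rw [r.real_E3_eq]; exact le_rfl
      eta_le_D := r.eta_le_D
      Wl_ge := r.Wl_ge
      t0_pos := r.real_t0_pos
      t0_le_one := r.real_t0_le_one
      e0_ge := by rw [r.real_e0_eq]
      cA_ge := archCoef_le
      Λ_ge := hΛ
      C_nonneg := hC0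
      T_ge := hTge
      Gt_ge := hGtge
      z_ge := hζle
      zm1H_ge := hζle.trans r.zetaHi_le_val_zm1H
      eml_ge := heml
      χ_ge := by rw [chiL_eq hm1]; exact le_rfl
      ra_ge := hra
      rb_ge := hrb
      rc_ge := hrc
      L_le := by rw [r.real_L_eq, ofRow2_q]
      gain_len_pos := r.inp_gainPairs_length_pos
      d_nonneg := by rw [r.real_d_eq]; positivity
      d_le := by rw [r.real_d_eq, ofRow2_δ]
      Ra_nonneg := hRa0
      Ra_le := hRa
      Rb_nonneg := hRb0
      Rb_le := hRb
      cb_ge := fun j _ ↦ by rw [r.real_τ]; exact irwinHall_le_cb hm1 j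
      cpb_ge := fun j _ t ht1 ht2 ↦ cpb_ge hm2 hC j t ht1 ht2
      layer_lo := hlo
      layer_hi := hhi }

/-! ## UC(q) for a certified row -/

/-- **UC(q) FOR A CERTIFIED TIER-2 ROW** (general `m`, named ℚ-facts as hypotheses): `T2Valid r.inp r.real ∧ RowFacts r` (cc-s2-1's
`check_sound`) and consecutive primes `q < q⁺` give `a*(S_q) < (log q⁺)/2` — hypothesis-free in `ψ` (Chebyshev). [THETA-CERT-cc6 §E; RH-FREE] -/
theorem uc2_of_valid (hV : T2Valid r.inp r.real) (hF : r.RowFacts) (hZ : ZetaHyp r.m) (hΛ : LambdaHyp r.m)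
    (hC : ∀ j < r.ncut, ¬ r.eta ≤ (j : ℚ) * TAU →
      IH (r.m - 1) (r.m * r.tstar j / r.eta) - IH (r.m - 1) (r.m * r.tstar j / r.eta - 1) ≤ ihPdf r.m (r.m * r.tstar j / r.eta))
    (hcons : Handoff.ConsecutivePrimes r.q r.qn) :
    MotivicDoor.SemilocalThreshold.weilSemilocalThreshold (Nat.primesBelow r.q) < Real.log r.qn / 2 := by
  have hq := hF.two_le_q
  have hM := matches_ofRow2 hF hZ hΛ hC
  have hA := admissible_ofRow2 hF
  have hcons' : Handoff.ConsecutivePrimes (ofRow2 r).q r.qn := hcons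
  have hN : Real.exp 2 ≤ Real.exp (-2 * (ofRow2 r).x₁) := by
    rw [neg_two_x₁]; exact Real.exp_le_exp.2 hF.logN
  have hCheb : Real.log 4 + 2 * (Real.log (Real.exp (-2 * (ofRow2 r).x₁)) / Real.sqrt (Real.exp (-2 * (ofRow2 r).x₁))) ≤ r.real.C :=
    (chebConst_eq hq).le
  exact (ofRow2 r).ucT2Cheb_of_valid hA hcons' hN hCheb hM hV

/-- **UC(q) FOR A CERTIFIED TIER-2 ROW WITH `m = 5`** (the campaign's rows; all named facts discharged: `zetaHyp_five`, `lambdaHyp_five`,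
`cutDer_five`) — the export cc-s2-1's 19172 closer consumes. [THETA-CERT-cc6 §E; RH-FREE] -/
theorem uc2_of_valid_five (hV : T2Valid r.inp r.real) (hF : r.RowFacts) (hm : r.m = 5) (hcons : Handoff.ConsecutivePrimes r.q r.qn) :
    MotivicDoor.SemilocalThreshold.weilSemilocalThreshold (Nat.primesBelow r.q) < Real.log r.qn / 2 := by
  have hZ : ZetaHyp r.m := by rw [hm]; exact ThetaTier1.zetaHyp_five
  have hΛ : LambdaHyp r.m := by rw [hm]; exact ThetaTier1.lambdaHyp_five
  exact uc2_of_valid hV hF hZ hΛ (cutDer_five hm) hcons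

end Row2

end

end Summit.RiemannHypothesis.RiemannHypothesis.Theorems.ThetaTier2
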